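import Literature.Probability.FitznerVanDerHofstad2017.SrwIntegralDimMonotoneAll
import Mathlib.Analysis.Normed.Module.Convex
import HarnessLib

/-!
# Monotonicity in the dimension of the ABSOLUTE SRW integrals `K_{n,l}(0)` and `K_{n,l}(±e_μ)` for
# EVERY `l` (the `K`-inputs of [NoBLE17] (3.36); `d`-monotonicity in the sense of [FvdH21] Def. 9.1)

CITATION HEADER. Part of the certified REPRODUCTION of R. Fitzner, R. van der Hofstad, *Generalized
approach to the non-backtracking lace expansion*, PTRF **169** (2017) [NoBLE17] — the SRW input
`K_{n,l}(x) = ∫ |D̂(k)|^l Ĉ(k)^n |D̂^{(x)}(k)| dk/(2π)^d` ((3.36) p. 1071; tree `srwK d n l x`,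
`SrwIntegralBounds.lean`) — and of the monotonicity-in-`d` device of R. Fitzner, R. van der Hofstad,
*NoBLE for lattice trees and lattice animals*, J. Stat. Phys. **185** (2021) no. 13 [FvdH21], §9: Def. 9.1
("`g^{(d)}(x^{(d)})` is monotone in `d` when `g^{(d+1)}((x^{(d)},0)) ≤ g^{(d)}(x^{(d)})`") and §9.1, where
for the integrals `K_{n,m}, T_{n,m}, U_n` NO monotonicity is proved in print: "We emphasize that we do
not claim that all integrals, such as `U_n`, are monotone decreasing in `d`, only that the bounds that
we rely upon are. The reason for this distinction is that the only monotonicity that we can actually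
prove is given by the two lemmas below" (Lemma 9.2: `I_{n,0}(x)`, `|x|_∞ ≤ 2`; Lemma 9.3: monotonicity
in `x`) (arXiv:1905.02785 p. 46).

WHAT IS PROVED HERE (kernel; elementary, no Bessel functions): for every `j`, EVERY `m` and `d ≥ 2j+1`,
`K^{(d+1)}_{j,m}(0) ≤ K^{(d)}_{j,m}(0)` (`srwK_zero_dim_succ_le`, `srwK_zero_dim_anti`), hence, since
`K_{n,l}(e_μ) = K_{n,l+1}(0)` (`srwK_single`, [NoBLE17] (3.34)/(3.36)), `K^{(d')}_{n,l}(e_{μ'}) ≤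
K^{(d)}_{n,l}(e_μ)` for `2n+1 ≤ d ≤ d'` and every `l` (`srwK_single_dim_anti`) — the `K`-reads of the
percolation notebook at `x ∈ {0, e₁}` (among them the `K_{n,l}(e₁)` cells of the f₂/f₃ bounds) are
monotone in `d`. For even `m`, `K_{j,m}(0) = I_{j,m}(0)` (`srwK_zero_even`) and this is
`srwI_zero_dim_succ_le`; the new content is odd `m`. PROOF: the leave-one-out Jensen argument of
`SrwIntegralLargeD.lean` (tail analyst gen 4) with the weight `|t|^m`: `K_{j,m}(0;d) = (2π)^{-d} ∫ ψ^K(D̂_d)`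
with `ψ^K_{j,m}(t) = |t|^m · ψ_{j,0}(t)` the even part of `|t|^m (1-t)^{-j}` (reflection `k ↦ k + π𝟙`);
for `|t| < 1`, `ψ^K_{j,m}(t) = Σ_{q even} C(q+j-1, j-1) |t|^{m+q}` is a non-negative combination of the
CONVEX functions `|t|^N` (`ConvexOn.pow` of the norm), so `ψ^K(mean) ≤ mean of ψ^K` termwise; `D̂_{d+1}(k)`
is the mean of the `d+1` coordinate-deleted `D̂_d(k^{(i)})` (`Dhat_succ_eq_avg`); integrate and delete
one coordinate (`integral_P_succ_comp_succAbove`).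

## References
* [NoBLE17] R. Fitzner, R. van der Hofstad, PTRF 169 (2017) 1041–1119: (3.34)–(3.36) p. 1071; §2.5
  p. 1062 and §6 p. 1104 (monotonicity in `d`, asserted). [FitznerVanDerHofstad2016NoBLE]
* [FvdH21] R. Fitzner, R. van der Hofstad, J. Stat. Phys. 185 (2021) no. 13, §9 Def. 9.1, §9.1
  (arXiv:1905.02785 p. 46). [FitznerVanDerHofstad2021LTLA]
* M. Heydenreich, R. van der Hofstad, Springer 2017, Exercise 5.4 / Prop. 5.5 (torus shift,
  integrability of `Ĉⁿ` for `d ≥ 2n+1`). [HeydenreichVanDerHofstad2017]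
-/

noncomputable section

open MeasureTheory Real Finset

namespace Literature.Probability.FitznerVanDerHofstad2017

open Literature.Barriers.CriticalPhenomena
open Literature.Barriers.CriticalPhenomena.Slade2006Prop53 (P μI)
open DimMono

variable {d : ℕ}

namespace KDimMono

/-- `D̂` is `2π`-periodic in every coordinate (local copy; the root-level lemma of
`HvdHTorusShift.lean` is private there). [folklore] -/
private theorem Dhat_add_twoPi_mulK (k : Fin d → ℝ) (n : Fin d → ℤ) :
    Dhat d (fun j => k j + 2 * π * n j) = Dhat d k := by
  simp only [Dhat]
  congr 1
  refine Finset.sum_congr rfl fun j _ => ?_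
  rw [mul_comm (2 * π), Real.cos_add_int_mul_two_pi]

/-- `K_{j,m}(0) = ∫ |D̂(k)|^m φ_{j,0}(D̂(k)) dk/(2π)^d`. [cite: FitznerVanDerHofstad2016NoBLE, (3.36) p. 1071] -/
theorem srwK_zero_eq_integral (d j m : ℕ) :
    srwK d j m 0 = (∫ k, |Dhat d k| ^ m * phi j 0 (Dhat d k) ∂P d) / (2 * π) ^ d := by
  simp only [srwK, DhatSym_zero, abs_one, mul_one, Chat, one_mul, phi, pow_zero]

/-- The integrand `|D̂|^m φ_{j,0}(D̂)` is measurable. [folklore] -/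
theorem measurable_absPow_mul_phi (d j m : ℕ) :
    Measurable (fun k : Fin d → ℝ => |Dhat d k| ^ m * phi j 0 (Dhat d k)) :=
  (((continuous_Dhat d).measurable.abs).pow_const m).mul
    ((measurable_phi j 0).comp (continuous_Dhat d).measurable)

/-- Reflection `k ↦ k + π𝟙`: `∫ |D̂|^m φ_{j,0}(-D̂) = ∫ |D̂|^m φ_{j,0}(D̂)` on the cube.
[cite: HeydenreichVanDerHofstad2017, Exercise 5.4 and (8.3.37)] -/
theorem integral_absPow_mul_phi_neg_Dhat (d j m : ℕ) :
    ∫ k, |Dhat d k| ^ m * phi j 0 (-Dhat d k) ∂P d = ∫ k, |Dhat d k| ^ m * phi j 0 (Dhat d k) ∂P d := by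
  have h := integral_P_comp_add (F := fun k => |Dhat d k| ^ m * phi j 0 (Dhat d k))
    (measurable_absPow_mul_phi d j m) (fun k n => by simp only [Dhat_add_twoPi_mulK]) (fun _ => π)
  simpa only [Dhat_add_pi, abs_neg] using h

/-- `|D̂|^m φ_{j,0}(D̂)` is integrable on the cube for `d ≥ 2j+1`.
[cite: HeydenreichVanDerHofstad2017, Prop. 5.5] -/
theorem integrable_absPow_mul_phi_Dhat {j : ℕ} (hd : 2 * j + 1 ≤ d) (m : ℕ) :
    Integrable (fun k => |Dhat d k| ^ m * phi j 0 (Dhat d k)) (P d) :=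
  (integrable_phi_Dhat hd 0).bdd_mul (((continuous_Dhat d).measurable.abs).pow_const m).aestronglyMeasurable
    (ae_of_all _ fun k => by
      rw [Real.norm_eq_abs, abs_pow, abs_abs]; exact abs_Dhat_pow_le_one m k)

/-- `|D̂|^m φ_{j,0}(-D̂)` is integrable on the cube for `d ≥ 2j+1`.
[cite: HeydenreichVanDerHofstad2017, Exercise 5.4 and Prop. 5.5] -/
theorem integrable_absPow_mul_phi_neg_Dhat {j : ℕ} (hd : 2 * j + 1 ≤ d) (m : ℕ) :
    Integrable (fun k => |Dhat d k| ^ m * phi j 0 (-Dhat d k)) (P d) :=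
  (integrable_phi_neg_Dhat hd 0).bdd_mul (((continuous_Dhat d).measurable.abs).pow_const m).aestronglyMeasurable
    (ae_of_all _ fun k => by
      rw [Real.norm_eq_abs, abs_pow, abs_abs]; exact abs_Dhat_pow_le_one m k)

/-- The even part of the `K`-integrand as a function of `t = D̂`: `ψ^K_{j,m}(t) = |t|^m ψ_{j,0}(t)`;
its integral equals that of `|D̂|^m φ_{j,0}(D̂)` (the odd part integrates to zero). [folklore] -/
theorem integral_psiK_Dhat {j : ℕ} (hd : 2 * j + 1 ≤ d) (m : ℕ) :
    ∫ k, |Dhat d k| ^ m * psi j 0 (Dhat d k) ∂P d = ∫ k, |Dhat d k| ^ m * phi j 0 (Dhat d k) ∂P d := by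
  have hsplit : (fun k : Fin d → ℝ => |Dhat d k| ^ m * psi j 0 (Dhat d k)) = fun k =>
      (|Dhat d k| ^ m * phi j 0 (Dhat d k) + |Dhat d k| ^ m * phi j 0 (-Dhat d k)) / 2 := by
    funext k; simp only [psi]; ring
  rw [hsplit, integral_div, integral_add (integrable_absPow_mul_phi_Dhat hd m)
    (integrable_absPow_mul_phi_neg_Dhat hd m), integral_absPow_mul_phi_neg_Dhat]
  ring

/-- `ψ^K_{j,m}(D̂)` is integrable on the cube for `d ≥ 2j+1`. [folklore] -/
theorem integrable_psiK_Dhat {j : ℕ} (hd : 2 * j + 1 ≤ d) (m : ℕ) :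
    Integrable (fun k => |Dhat d k| ^ m * psi j 0 (Dhat d k)) (P d) := by
  have h := ((integrable_absPow_mul_phi_Dhat hd m).add (integrable_absPow_mul_phi_neg_Dhat hd m)).div_const 2
  refine h.congr (ae_of_all _ fun k => ?_)
  simp only [Pi.add_apply, psi]; ring

/-- `t ↦ |t|^N` is convex on `ℝ`. [folklore] -/
theorem convexOn_abs_pow (N : ℕ) : ConvexOn ℝ Set.univ (fun t : ℝ => |t| ^ N) := by
  have h := (convexOn_univ_norm (E := ℝ)).pow (fun x _ => norm_nonneg x) N
  refine h.congr fun t _ => ?_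
  simp only [Pi.pow_apply, Real.norm_eq_abs]

/-- `t ↦ |t|^m (t^N + (-t)^N)/2` is convex on `ℝ` (it is `|t|^{m+N}` for even `N`, `0` for odd `N`).
[folklore] -/
theorem convexOn_absPow_mul_evenPart_pow (m N : ℕ) :
    ConvexOn ℝ Set.univ (fun t : ℝ => |t| ^ m * ((t ^ N + (-t) ^ N) / 2)) := by
  rcases Nat.even_or_odd N with hN | hN
  · have : (fun t : ℝ => |t| ^ m * ((t ^ N + (-t) ^ N) / 2)) = fun t => |t| ^ (m + N) := by
      funext t
      rw [hN.neg_pow, pow_add, ← hN.pow_abs]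
      ring
    rw [this]; exact convexOn_abs_pow (m + N)
  · have : (fun t : ℝ => |t| ^ m * ((t ^ N + (-t) ^ N) / 2)) = fun _ => (0 : ℝ) := by
      funext t; rw [hN.neg_pow]; ring
    rw [this]; exact convexOn_const 0 convex_univ

/-- **Jensen for `ψ^K`**: `ψ^K` of an average of numbers in `(-1,1)` is at most the average of `ψ^K`
(`ψ^K_{j,m}` is a non-negative combination of the convex functions `|t|^m (t^n + (-t)^n)/2`). [folklore] -/
theorem psiK_avg_le (j m : ℕ) (s : Fin (d + 1) → ℝ) (hs : ∀ i, |s i| < 1) :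
    |(∑ i, s i) / (d + 1)| ^ m * psi j 0 ((∑ i, s i) / (d + 1)) ≤
      (∑ i, |s i| ^ m * psi j 0 (s i)) / (d + 1) := by
  have havg : |(∑ i, s i) / (d + 1)| < 1 := by
    have hw : (0 : ℝ) < (d : ℝ) + 1 := by positivity
    rw [abs_div, abs_of_pos hw, div_lt_one hw]
    calc |∑ i, s i| ≤ ∑ i, |s i| := abs_sum_le_sum_abs _ _
      _ < ∑ _i : Fin (d + 1), (1 : ℝ) := sum_lt_sum_of_nonempty univ_nonempty fun i _ => hs i
      _ = (d : ℝ) + 1 := by simp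
  cases j with
  | zero =>
    have hpsi : ∀ t : ℝ, |t| ^ m * psi 0 0 t = |t| ^ m * ((t ^ 0 + (-t) ^ 0) / 2) := by
      intro t; simp [psi, phi]
    simp only [hpsi]
    exact (convexOn_absPow_mul_evenPart_pow m 0).map_avg_le s
  | succ q =>
    have hA := (hasSum_psi q 0 havg).mul_left (|(∑ i, s i) / (d + 1)| ^ m)
    have hB : HasSum (fun n : ℕ => (((n + q).choose q : ℕ) : ℝ) *
        ((∑ i, |s i| ^ m * (((s i) ^ (n + 0) + (-(s i)) ^ (n + 0)) / 2)) / (d + 1)))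
        ((∑ i, |s i| ^ m * psi (q + 1) 0 (s i)) / (d + 1)) := by
      have h := (hasSum_sum (s := (univ : Finset (Fin (d + 1))))
        (fun i _ => (hasSum_psi q 0 (hs i)).mul_left (|s i| ^ m))).div_const ((d : ℝ) + 1)
      have hf : (fun n : ℕ => (((n + q).choose q : ℕ) : ℝ) *
          ((∑ i, |s i| ^ m * (((s i) ^ (n + 0) + (-(s i)) ^ (n + 0)) / 2)) / (d + 1))) =
          fun n : ℕ => (∑ i, |s i| ^ m * ((((n + q).choose q : ℕ) : ℝ) *
            (((s i) ^ (n + 0) + (-(s i)) ^ (n + 0)) / 2))) / ((d : ℝ) + 1) := by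
        funext n
        rw [mul_div_assoc', mul_sum]
        congr 1
        exact sum_congr rfl fun i _ => by ring
      rw [hf]; exact h
    have hA' : HasSum (fun n : ℕ => (((n + q).choose q : ℕ) : ℝ) *
        (|(∑ i, s i) / (d + 1)| ^ m * ((((∑ i, s i) / (d + 1)) ^ (n + 0) +
          (-((∑ i, s i) / (d + 1))) ^ (n + 0)) / 2)))
        (|(∑ i, s i) / (d + 1)| ^ m * psi (q + 1) 0 ((∑ i, s i) / (d + 1))) := by
      refine hA.congr_fun fun n => ?_
      ring
    refine hasSum_le (fun n => ?_) hA' hB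
    exact mul_le_mul_of_nonneg_left ((convexOn_absPow_mul_evenPart_pow m (n + 0)).map_avg_le s)
      (Nat.cast_nonneg _)

/-- The Jensen step at the level of integrals:
`∫_{[-π,π]^{d+1}} ψ^K(D̂_{d+1}) ≤ 2π ∫_{[-π,π]^d} ψ^K(D̂_d)` (`d ≥ 2j+1`). [folklore] -/
theorem integral_psiK_succ_le {j : ℕ} (hd : 2 * j + 1 ≤ d) (m : ℕ) :
    ∫ k, |Dhat (d + 1) k| ^ m * psi j 0 (Dhat (d + 1) k) ∂P (d + 1) ≤
      (2 * π) * ∫ k, |Dhat d k| ^ m * psi j 0 (Dhat d k) ∂P d := by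
  have hd1 : 2 * j + 1 ≤ d + 1 := by omega
  have hd0 : 1 ≤ d := by omega
  have hpt : ∀ᵐ k ∂P (d + 1), |Dhat (d + 1) k| ^ m * psi j 0 (Dhat (d + 1) k) ≤
      (∑ i : Fin (d + 1), |Dhat d (fun l => k (i.succAbove l))| ^ m *
        psi j 0 (Dhat d (fun l => k (i.succAbove l)))) / (d + 1) := by
    filter_upwards [ae_forall_sin_ne_zero (d + 1)] with k hk
    rw [Dhat_succ_eq_avg hd0 k]
    exact psiK_avg_le j m _ fun i => abs_Dhat_lt_one hd0 fun l => abs_cos_lt_one_of_sin_ne_zero (hk _)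
  have hint : ∀ i : Fin (d + 1), Integrable
      (fun k : Fin (d + 1) → ℝ => |Dhat d (fun l => k (i.succAbove l))| ^ m *
        psi j 0 (Dhat d (fun l => k (i.succAbove l)))) (P (d + 1)) :=
    fun i => integrable_P_succ_comp_succAbove i
      (G := fun k' => |Dhat d k'| ^ m * psi j 0 (Dhat d k')) (integrable_psiK_Dhat hd m)
  calc ∫ k, |Dhat (d + 1) k| ^ m * psi j 0 (Dhat (d + 1) k) ∂P (d + 1)
      ≤ ∫ k, (∑ i : Fin (d + 1), |Dhat d (fun l => k (i.succAbove l))| ^ m *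
          psi j 0 (Dhat d (fun l => k (i.succAbove l)))) / (d + 1) ∂P (d + 1) :=
        integral_mono_ae (integrable_psiK_Dhat hd1 m)
          ((integrable_finsetSum _ fun i _ => hint i).div_const _) hpt
    _ = (∑ i : Fin (d + 1), ∫ k, |Dhat d (fun l => k (i.succAbove l))| ^ m *
          psi j 0 (Dhat d (fun l => k (i.succAbove l))) ∂P (d + 1)) / (d + 1) := by
        rw [integral_div, integral_finsetSum _ fun i _ => hint i]
    _ = (∑ _i : Fin (d + 1), (2 * π) * ∫ k, |Dhat d k| ^ m * psi j 0 (Dhat d k) ∂P d) / (d + 1) := by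
        congr 1
        exact sum_congr rfl fun i _ =>
          integral_P_succ_comp_succAbove d i (fun k' => |Dhat d k'| ^ m * psi j 0 (Dhat d k'))
    _ = (2 * π) * ∫ k, |Dhat d k| ^ m * psi j 0 (Dhat d k) ∂P d := by
        rw [sum_const, card_univ, Fintype.card_fin, nsmul_eq_mul]
        have hw : (d : ℝ) + 1 ≠ 0 := by positivity
        push_cast
        field_simp

end KDimMono

open KDimMono in
/-- **Monotonicity of the absolute SRW integrals in the dimension, every `m`.** For `d ≥ 2j+1`,
`K^{(d+1)}_{j,m}(0) ≤ K^{(d)}_{j,m}(0)`. For even `m` this is `srwI_zero_dim_succ_le` (`K = I`,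
`srwK_zero_even`); for odd `m` it is new: [FvdH21] §9.1 proves no `d`-monotonicity for `K`-integrals.
[cite: FitznerVanDerHofstad2021LTLA, §9 Def. 9.1 and §9.1 (no monotonicity claimed for K, T, U)]
[cite: FitznerVanDerHofstad2016NoBLE, (3.36) p. 1071; §2.5 p. 1062 (monotonicity in d, asserted)] -/
theorem srwK_zero_dim_succ_le {j : ℕ} (hd : 2 * j + 1 ≤ d) (m : ℕ) :
    srwK (d + 1) j m 0 ≤ srwK d j m 0 := by
  have hd1 : 2 * j + 1 ≤ d + 1 := by omega
  rw [srwK_zero_eq_integral, srwK_zero_eq_integral, ← integral_psiK_Dhat hd1,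
    ← integral_psiK_Dhat hd, pow_succ]
  calc (∫ k, |Dhat (d + 1) k| ^ m * psi j 0 (Dhat (d + 1) k) ∂P (d + 1)) / ((2 * π) ^ d * (2 * π))
      ≤ ((2 * π) * ∫ k, |Dhat d k| ^ m * psi j 0 (Dhat d k) ∂P d) / ((2 * π) ^ d * (2 * π)) :=
        div_le_div_of_nonneg_right (integral_psiK_succ_le hd m) (by positivity)
    _ = (∫ k, |Dhat d k| ^ m * psi j 0 (Dhat d k) ∂P d) / (2 * π) ^ d := by
        rw [mul_comm (2 * π) (∫ k, |Dhat d k| ^ m * psi j 0 (Dhat d k) ∂P d),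
          mul_div_mul_right _ _ (by positivity : (2 : ℝ) * π ≠ 0)]

/-- `K^{(d')}_{j,m}(0) ≤ K^{(d)}_{j,m}(0)` for `2j+1 ≤ d ≤ d'`, every `m`.
[cite: FitznerVanDerHofstad2021LTLA, §9 Def. 9.1] -/
theorem srwK_zero_dim_anti {j m d d' : ℕ} (hd : 2 * j + 1 ≤ d) (hdd' : d ≤ d') :
    srwK d' j m 0 ≤ srwK d j m 0 := by
  induction d', hdd' using Nat.le_induction with
  | base => exact le_rfl
  | succ d' hle ih => exact (srwK_zero_dim_succ_le (by omega) m).trans ih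

/-- **The `K`-reads at the unit vectors are monotone in `d`, every `l`**:
`K^{(d')}_{n,l}(e_{μ'}) ≤ K^{(d)}_{n,l}(e_μ)` for `2n+1 ≤ d ≤ d'` (`K_{n,l}(e_μ) = K_{n,l+1}(0)`, `srwK_single`).
[cite: FitznerVanDerHofstad2016NoBLE, (3.34), (3.36) p. 1071] [cite: FitznerVanDerHofstad2021LTLA, §9 Def. 9.1] -/
theorem srwK_single_dim_anti {n l d d' : ℕ} (hd : 2 * n + 1 ≤ d) (hdd' : d ≤ d')
    (μ : Fin d) (μ' : Fin d') : srwK d' n l (Pi.single μ' 1) ≤ srwK d n l (Pi.single μ 1) := by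
  rw [srwK_single, srwK_single]
  exact srwK_zero_dim_anti hd hdd'

end Literature.Probability.FitznerVanDerHofstad2017

end
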